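import Summits.NavierStokesRegularity.NavierStokesRegularity.Theorems.TypeILiouvilleTypeIliouvilleNoTypeIITypeIIZoomPackage
import Literature.Analysis.FluidPDE.KNSSRemark61

/-!
# `TypeIliouvilleNoTypeII` (stmt-NavierStokesRegularity-0056): the RIGIDITY slot of the Type-II zoom skeleton must kill constants

Negative (support) lemmas for the §B programme «Type-II-exclusion estimates» (D-0081), critic seat
ns-typeII-critic-2, K-READ row M10 of `KILLKIT.md`, in the EXACT frame of the landed uniform skeleton
`Theorems.TypeIliouvilleNoTypeII.TypeIIZoom.typeIliouvilleNoTypeII_of_transfer_of_rigidity` (ns-typeII-p2,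
`Theorems/TypeILiouvilleTypeIliouvilleNoTypeIITypeIIZoomPackage.lean`): a candidate estimate `E` closes the
crux through that theorem by supplying TRANSFER (`¬ Type I ⇒ P v` for the zoom limit `v`) and RIGIDITY
(every bounded eternal Oseen-mild smooth divergence-free `v` with `‖v‖ ≤ 2` and `P v` has `v 0 0 = 0`).

* `const_eternalOseenMild` — a CONSTANT field `v ≡ b` is a bounded eternal Oseen-mild smooth
  divergence-free field in exactly that sense (`e^{(t−s)Δ} b = b`:
  `Literature.Analysis.UnboundedOperators.heatExtension_const`; the Duhamel term of spatially constant
  fields vanishes: `Literature.Analysis.FluidPDE.oseenDuhamel_eq_zero_of_const`, KNSS 2009 §4).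
* `rigidity_false_of_holds_on_const` — TEMPLATE: if the transferred property `P` holds on ONE non-zero
  constant `b` with `‖b‖ ≤ 2`, the RIGIDITY hypothesis is FALSE.  So every §B candidate run through the
  skeleton owes a `P` that FAILS on non-zero constants — a clause built from `∇v`, `curl v`, the strain,
  oscillations or alignment angles alone (all trivial on constants) cannot be the whole of `P`; in the
  Type-I theory the inherited rate is what kills constants
  (`Literature.Analysis.FluidPDE.IsTypeIAncientMild.eq_zero_of_slice_const`), and the Type-II package
  exports no such decay.
* `rigidity_false_of_vanishingGradient` — INSTANCE: `P v := (∀ t y, fderiv ℝ (v t) y = 0)` («the limit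
  is gradient-free / unstrained / irrotational and shearless») satisfies TRANSFER-type heuristics of every
  gradient-depletion mechanism and is USELESS: rigidity fails on `b = e₀`.
* `bare_rigidity_false` — INSTANCE `P := ⊤`: the package alone concludes nothing.

WHAT THIS IS NOT: not a statement about Navier–Stokes blow-up; bookkeeping of the constant eternal flows
(KNSS 2009, §1 p. 3) against the rigidity slot. [folklore]
-/

noncomputable section

set_option linter.dupNamespace false

namespace Summit.NavierStokesRegularity.NavierStokesRegularity.Theorems.TypeIliouvilleNoTypeIINegative

open Set Function
open Literature.Analysis Literature.Analysis.FluidPDE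

/-- **Constants are bounded eternal Oseen-mild smooth divergence-free fields** in the sense of the
Type-II zoom skeleton: jointly smooth, divergence-free, `v(t) = e^{(t−s)Δ} v(s) − B¹_s(v,v)(t)` for all
`s < t`, and bounded by `‖b‖`. [cite: KochNadirashviliSereginSverak2009, §1 p. 3 and §4] -/
theorem const_eternalOseenMild (b : EuclideanSpace ℝ (Fin 3)) :
    ContDiff ℝ (⊤ : ℕ∞) (uncurry (fun (_ : ℝ) (_ : EuclideanSpace ℝ (Fin 3)) => b)) ∧
    (∀ t : ℝ, VectorCalculus.IsDivFree ((fun (_ : ℝ) (_ : EuclideanSpace ℝ (Fin 3)) => b) t)) ∧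
    (∀ s t : ℝ, s < t → ∀ x : EuclideanSpace ℝ (Fin 3),
      (fun (_ : ℝ) (_ : EuclideanSpace ℝ (Fin 3)) => b) t x =
        heatFlow ((fun (_ : ℝ) (_ : EuclideanSpace ℝ (Fin 3)) => b) s) (t - s) x -
          oseenDuhamel 1 s (fun (_ : ℝ) (_ : EuclideanSpace ℝ (Fin 3)) => b)
            (fun (_ : ℝ) (_ : EuclideanSpace ℝ (Fin 3)) => b) t x) ∧
    (∀ (t : ℝ) (x : EuclideanSpace ℝ (Fin 3)),
      ‖(fun (_ : ℝ) (_ : EuclideanSpace ℝ (Fin 3)) => b) t x‖ ≤ ‖b‖) := by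
  refine ⟨contDiff_const, fun t x => by simp [VectorCalculus.divergence], fun s t hst x => ?_,
    fun _ _ => le_rfl⟩
  have hpos : 0 < t - s := sub_pos.2 hst
  have hheat : heatFlow (fun _ : EuclideanSpace ℝ (Fin 3) => b) (t - s) x = b := by
    rw [heatFlow_of_pos _ hpos]
    exact UnboundedOperators.heatExtension_const b hpos x
  have hduh : oseenDuhamel 1 s (fun (_ : ℝ) (_ : EuclideanSpace ℝ (Fin 3)) => b)
      (fun (_ : ℝ) (_ : EuclideanSpace ℝ (Fin 3)) => b) t x = 0 :=
    oseenDuhamel_eq_zero_of_const (b := fun _ => b) (c := fun _ => b)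
      (fun _ _ _ => rfl) (fun _ _ _ => rfl) x
  simp only [hheat, hduh, sub_zero]

/-- **TEMPLATE (M10, rigidity slot).** If the transferred property `P` holds on one NON-ZERO constant
field `v ≡ b` with `‖b‖ ≤ 2`, the RIGIDITY hypothesis of
`TypeIIZoom.typeIliouvilleNoTypeII_of_transfer_of_rigidity` is false. [folklore] -/
theorem rigidity_false_of_holds_on_const
    (P : (ℝ → EuclideanSpace ℝ (Fin 3) → EuclideanSpace ℝ (Fin 3)) → Prop)
    {b : EuclideanSpace ℝ (Fin 3)} (hb0 : b ≠ 0) (hb2 : ‖b‖ ≤ 2)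
    (hP : P (fun (_ : ℝ) (_ : EuclideanSpace ℝ (Fin 3)) => b)) :
    ¬ (∀ v : ℝ → EuclideanSpace ℝ (Fin 3) → EuclideanSpace ℝ (Fin 3),
        ContDiff ℝ (⊤ : ℕ∞) (uncurry v) →
        (∀ t, VectorCalculus.IsDivFree (v t)) →
        (∀ s t : ℝ, s < t → ∀ x, v t x = heatFlow (v s) (t - s) x - oseenDuhamel 1 s v v t x) →
        (∀ t x, ‖v t x‖ ≤ 2) → P v → v 0 0 = 0) := by
  intro h
  obtain ⟨h1, h2, h3, h4⟩ := const_eternalOseenMild b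
  exact hb0 (h (fun _ _ => b) h1 h2 h3 (fun t x => (h4 t x).trans hb2) hP)

/-- The unit vector `e₀` has norm one. [folklore] -/
theorem norm_single_zero_one :
    ‖(EuclideanSpace.single (0 : Fin 3) (1 : ℝ) : EuclideanSpace ℝ (Fin 3))‖ = 1 := by simp

/-- The unit vector `e₀` is non-zero. [folklore] -/
theorem single_zero_one_ne_zero :
    (EuclideanSpace.single (0 : Fin 3) (1 : ℝ) : EuclideanSpace ℝ (Fin 3)) ≠ 0 := by
  intro h
  have := norm_single_zero_one
  rw [h, norm_zero] at this
  exact zero_ne_one this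

/-- **INSTANCE (M10).** The gradient-free property `P v := ∀ t y, fderiv ℝ (v t) y = 0` — what every
gradient-, vorticity-, strain- or alignment-depletion clause degenerates to on the limit — does NOT make
the rigidity slot true: constants are gradient-free and non-zero. [folklore] -/
theorem rigidity_false_of_vanishingGradient :
    ¬ (∀ v : ℝ → EuclideanSpace ℝ (Fin 3) → EuclideanSpace ℝ (Fin 3),
        ContDiff ℝ (⊤ : ℕ∞) (uncurry v) →
        (∀ t, VectorCalculus.IsDivFree (v t)) →
        (∀ s t : ℝ, s < t → ∀ x, v t x = heatFlow (v s) (t - s) x - oseenDuhamel 1 s v v t x) →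
        (∀ t x, ‖v t x‖ ≤ 2) → (∀ t y, fderiv ℝ (v t) y = 0) → v 0 0 = 0) :=
  rigidity_false_of_holds_on_const (fun v => ∀ t y, fderiv ℝ (v t) y = 0) single_zero_one_ne_zero
    (by rw [norm_single_zero_one]; norm_num) (fun _ _ => by simp)

/-- **INSTANCE (M10).** The bare rigidity (`P := ⊤`) is false: the Type-II zoom package alone concludes
nothing; all content is in the pair (TRANSFER `P`, RIGIDITY for `P`) with `P` failing on constants. [folklore] -/
theorem bare_rigidity_false :
    ¬ (∀ v : ℝ → EuclideanSpace ℝ (Fin 3) → EuclideanSpace ℝ (Fin 3),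
        ContDiff ℝ (⊤ : ℕ∞) (uncurry v) →
        (∀ t, VectorCalculus.IsDivFree (v t)) →
        (∀ s t : ℝ, s < t → ∀ x, v t x = heatFlow (v s) (t - s) x - oseenDuhamel 1 s v v t x) →
        (∀ t x, ‖v t x‖ ≤ 2) → True → v 0 0 = 0) :=
  rigidity_false_of_holds_on_const (fun _ => True) single_zero_one_ne_zero
    (by rw [norm_single_zero_one]; norm_num) trivial

end Summit.NavierStokesRegularity.NavierStokesRegularity.Theorems.TypeIliouvilleNoTypeIINegative

end
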